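import Literature.RepresentationTheory.Virasoro.ShapovalovForm
import Literature.RepresentationTheory.Virasoro.SingularVectors
import Mathlib.LinearAlgebra.Matrix.ToLinearEquiv

/-!
# The Gram (Shapovalov / Kac) determinants of the Verma module

`det(c,h)_N` is the determinant of the contravariant form on `V(c,h)_{h+N}` in the PBW basis
`e_𝕀 v_{c,h}`, `𝕀 ⊢ N` (Iohara–Koga Definition 4.1). We prove the elementary facts used in the
proof of the Kac determinant formula (Iohara–Koga §4.4.2, Lemma 4.14 "`M(c,h₀)` has a singular
vector of level `k`, since `det(c,h₀)_k = 0` and `det(c,h₀)_l ≠ 0` for `l < k`"):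

* `det(c,h)_N = 0 ↔ rad ∩ V(c,h)_{h+N} ≠ 0` (`Verma.gramDet_eq_zero_iff`);
* the lowest level where the radical is non-zero carries a singular vector
  (`Verma.exists_singular_of_rad_inf_ne_bot`);
* hence `det(c,h)_N = 0` iff `V(c,h)` has a singular vector of some level `1 ≤ M ≤ N`
  (`Verma.gramDet_eq_zero_iff_exists_singular`), the levels `< N` being non-degenerate iff `M = N`
  can be forced.

## Not here

The determinant FORMULA (Iohara–Koga Theorem 4.2): `det(c,h)_N ∝ ∏_{rs ≤ N} Φ_{r,s}(c,h)^{p(N-rs)}`.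
-/

noncomputable section

namespace Literature.RepresentationTheory.Virasoro

namespace Verma

variable {c h : ℂ}

/-- The **Gram matrix** of the contravariant form on `V(c,h)_{h+N}` in the PBW basis.
[cite: IoharaKoga2011, Definition 4.1 and §4.4.2] -/
def gram (N : ℕ) : Matrix (Nat.Partition N) (Nat.Partition N) ℂ :=
  fun p q => form ((rep c h).partitionVector p (hw c h)) ((rep c h).partitionVector q (hw c h))

variable (c h) in
/-- The **Kac / Shapovalov determinant** `det(c,h)_N`. [cite: IoharaKoga2011, Definition 4.1] -/
def gramDet (N : ℕ) : ℂ := (gram (c := c) (h := h) N).det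

/-- A vector of `V(c,h)_{h+N}` orthogonal to `V(c,h)_{h+N}` lies in the radical (the other levels
being orthogonal automatically). [cite: IoharaKoga2011, §4.4.1] -/
theorem mem_rad_of_forall_levelSpace {N : ℕ} {x : Verma c h} (hx : x ∈ (rep c h).levelSpace (hw c h) N)
    (horth : ∀ y ∈ (rep c h).levelSpace (hw c h) N, form x y = 0) : x ∈ rad := by
  rw [mem_rad]
  intro y
  have hy : y ∈ ⨆ M, (rep c h).levelSpace (hw c h) M := by
    rw [(rep c h).iSup_levelSpace_eq_top isPrimary_hw generated_hw_eq_top]; trivial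
  induction hy using Submodule.iSup_induction' with
  | mem M y hy =>
    by_cases hMN : N = M
    · subst hMN; exact horth y hy
    · exact form_eq_zero_of_ne hMN hx hy
  | zero => rw [map_zero]
  | add y y' _ _ hy hy' => rw [map_add, hy, hy', add_zero]

/-- **`det(c,h)_N = 0 ↔ rad ∩ V(c,h)_{h+N} ≠ 0`.** [cite: IoharaKoga2011, §4.4.2 (Lemma 4.13–4.14) and Proposition 3.4] -/
theorem gramDet_eq_zero_iff (N : ℕ) :
    gramDet c h N = 0 ↔ rad ⊓ (rep c h).levelSpace (hw c h) N ≠ ⊥ := by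
  classical
  set e : Nat.Partition N → Verma c h := fun p => (rep c h).partitionVector p (hw c h) with he
  have hind := linearIndependent_partitionVector c h N
  -- `⟨Σ a_p e_p, e_q⟩ = (a ᵥ* gram) q`
  have hvec : ∀ (a : Nat.Partition N → ℂ) (q : Nat.Partition N),
      form (∑ p, a p • e p) (e q) = Matrix.vecMul a (gram (c := c) (h := h) N) q := by
    intro a q
    rw [map_sum, LinearMap.sum_apply]
    simp only [map_smul, LinearMap.smul_apply, smul_eq_mul, Matrix.vecMul, dotProduct, gram, he]
  have hmem : ∀ a : Nat.Partition N → ℂ, ∑ p, a p • e p ∈ (rep c h).levelSpace (hw c h) N := fun a =>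
    Submodule.sum_mem _ fun p _ => Submodule.smul_mem _ _ ((rep c h).partitionVector_mem_levelSpace _ p)
  constructor
  · intro hdet
    obtain ⟨a, ha0, ha⟩ := Matrix.exists_vecMul_eq_zero_iff.mpr hdet
    rw [Submodule.ne_bot_iff]
    refine ⟨∑ p, a p • e p, ⟨?_, hmem a⟩, ?_⟩
    · refine mem_rad_of_forall_levelSpace (hmem a) fun y hy => ?_
      induction hy using Submodule.span_induction with
      | mem y hy =>
        obtain ⟨q, rfl⟩ := hy
        rw [hvec a q, ha, Pi.zero_apply]
      | zero => rw [map_zero]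
      | add y y' _ _ hy hy' => rw [map_add, hy, hy', add_zero]
      | smul t y _ hy => rw [map_smul, hy, smul_zero]
    · intro h0
      apply ha0
      funext p
      exact Fintype.linearIndependent_iff.mp hind a h0 p
  · intro hne
    obtain ⟨x, ⟨hxrad, hxlev⟩, hx0⟩ := (Submodule.ne_bot_iff _).mp hne
    obtain ⟨a, rfl⟩ := (Submodule.mem_span_range_iff_exists_fun ℂ).mp hxlev
    refine Matrix.exists_vecMul_eq_zero_iff.mp ⟨a, fun ha => hx0 ?_, ?_⟩
    · rw [ha]
      exact Finset.sum_eq_zero fun p _ => by rw [Pi.zero_apply, zero_smul']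
    · funext q
      rw [← hvec a q, Pi.zero_apply]
      exact mem_rad.mp hxrad _

/-- The radical does not meet the level-`0` line `ℂ v_{c,h}`. [cite: IoharaKoga2011, §4.4.1 (2)] -/
theorem rad_inf_levelSpace_zero : rad ⊓ (rep c h).levelSpace (hw c h) 0 = ⊥ := by
  rw [eq_bot_iff]
  rintro x ⟨hxrad, hx0⟩
  have hx0' : x ∈ ℂ ∙ hw c h := by rw [← levelSpace_zero]; exact hx0
  rw [Submodule.mem_span_singleton] at hx0'
  obtain ⟨t, rfl⟩ := hx0'
  have h1 := mem_rad.mp hxrad (hw c h)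
  rw [map_smul, LinearMap.smul_apply, form_hw_hw, smul_eq_mul, mul_one] at h1
  rw [Submodule.mem_bot, h1, zero_smul']

/-- Raising operators lower the level. [folklore] -/
theorem L_pos_mem_levelSpace {M m : ℕ} (hmM : m ≤ M) {x : Verma c h}
    (hx : x ∈ (rep c h).levelSpace (hw c h) M) : (rep c h).L m x ∈ (rep c h).levelSpace (hw c h) (M - m) := by
  have hx' : x ∈ (rep c h).weightSpace (h + M) :=
    (rep c h).levelSpace_le_weightSpace isPrimary_hw.mem_weightSpace M hx
  have h1 := (rep c h).apply_mem_eigenspace hx' m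
  rw [show (h + (M : ℂ) - ((m : ℕ) : ℤ) : ℂ) = h + ((M - m : ℕ) : ℂ) by
    push_cast [Nat.cast_sub hmM]; ring] at h1
  rwa [← (rep c h).weightSpace_eq_levelSpace isPrimary_hw generated_hw_eq_top (M - m)]

/-- **The lowest degenerate level carries a singular vector**: if `rad ∩ V(c,h)_{h+N} ≠ 0` then
`V(c,h)` has a singular vector of some level `1 ≤ M ≤ N` (a non-zero vector of the lowest level of
the graded subrepresentation `rad`). [cite: IoharaKoga2011, Lemma 4.14 (proof: "M(c,h₀) has a singular vector v_k of level k, since det(c,h₀)_k = 0 and det(c,h₀)_l ≠ 0 for l < k")] -/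
theorem exists_singular_of_rad_inf_ne_bot {N : ℕ} (hN : rad ⊓ (rep c h).levelSpace (hw c h) N ≠ ⊥) :
    ∃ M : ℕ, 1 ≤ M ∧ M ≤ N ∧ (∀ m, m < M → rad ⊓ (rep c h).levelSpace (hw c h) m = ⊥) ∧
      ∃ w : Verma c h, w ≠ 0 ∧ w ∈ (rep c h).levelSpace (hw c h) M ∧
        ∀ m : ℕ, 1 ≤ m → (rep c h).L m w = 0 := by
  classical
  have hex : ∃ m, rad ⊓ (rep c h).levelSpace (hw c h) m ≠ ⊥ := ⟨N, hN⟩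
  set M := Nat.find hex with hM_def
  have hM : rad ⊓ (rep c h).levelSpace (hw c h) M ≠ ⊥ := Nat.find_spec hex
  have hmin : ∀ m, m < M → rad ⊓ (rep c h).levelSpace (hw c h) m = ⊥ := fun m hm => by
    have := Nat.find_min hex hm
    push Not at this
    exact this
  have hM0 : M ≠ 0 := fun h0 => by
    rw [h0] at hM
    exact hM rad_inf_levelSpace_zero
  obtain ⟨w, ⟨hwrad, hwlev⟩, hw0⟩ := (Submodule.ne_bot_iff _).mp hM
  refine ⟨M, by omega, Nat.find_le hN, hmin, w, hw0, hwlev, fun m hm => ?_⟩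
  by_cases hmM : m ≤ M
  · have h1 : (rep c h).L m w ∈ rad ⊓ (rep c h).levelSpace (hw c h) (M - m) :=
      ⟨isInvariant_rad _ _ hwrad, L_pos_mem_levelSpace hmM hwlev⟩
    rw [hmin (M - m) (by omega), Submodule.mem_bot] at h1
    exact h1
  · exact L_pos_apply_eq_zero_of_lt (by omega) hwlev

/-- **`det(c,h)_N = 0` iff `V(c,h)` has a singular vector of some level `1 ≤ M ≤ N`.**
[cite: IoharaKoga2011, §4.4.2 (Lemma 4.14) and Proposition 3.4] -/
theorem gramDet_eq_zero_iff_exists_singular (N : ℕ) :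
    gramDet c h N = 0 ↔ ∃ M : ℕ, 1 ≤ M ∧ M ≤ N ∧ ∃ w : Verma c h, w ≠ 0 ∧
      w ∈ (rep c h).levelSpace (hw c h) M ∧ ∀ m : ℕ, 1 ≤ m → (rep c h).L m w = 0 := by
  rw [gramDet_eq_zero_iff]
  constructor
  · intro hN
    obtain ⟨M, hM1, hMN, -, w, hw0, hwlev, hsing⟩ := exists_singular_of_rad_inf_ne_bot hN
    exact ⟨M, hM1, hMN, w, hw0, hwlev, hsing⟩
  · rintro ⟨M, hM1, hMN, w, hw0, hwlev, hsing⟩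
    exact rad_inf_levelSpace_ne_bot_of_singular (by omega) hMN hw0 hwlev hsing

/-- **The first degenerate level is the level of a singular vector**: if `det(c,h)_N = 0` and
`det(c,h)_l ≠ 0` for all `l < N`, then `V(c,h)` has a singular vector of level exactly `N`.
[cite: IoharaKoga2011, Lemma 4.14 (proof)] -/
theorem exists_singular_of_gramDet_eq_zero_of_lt {N : ℕ} (hN : gramDet c h N = 0)
    (hlt : ∀ l, l < N → gramDet c h l ≠ 0) :
    ∃ w : Verma c h, w ≠ 0 ∧ w ∈ (rep c h).levelSpace (hw c h) N ∧ ∀ m : ℕ, 1 ≤ m → (rep c h).L m w = 0 := by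
  obtain ⟨M, hM1, hMN, w, hw0, hwlev, hsing⟩ := (gramDet_eq_zero_iff_exists_singular N).mp hN
  rcases eq_or_lt_of_le hMN with rfl | hlt'
  · exact ⟨w, hw0, hwlev, hsing⟩
  · exact absurd ((gramDet_eq_zero_iff_exists_singular M).mpr ⟨M, hM1, le_rfl, w, hw0, hwlev, hsing⟩) (hlt M hlt')

end Verma

end Literature.RepresentationTheory.Virasoro

end
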